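import Mathlib.FieldTheory.Finite.GaloisField
import Mathlib.NumberTheory.Multiplicity
import Mathlib.Data.Nat.ModEq
import HarnessLib

/-!
# The residue field `𝔽_{p^f}` of the `C_p ⋊ C_{2^{a+2}}` norm obstruction: the CRT exponent, a primitive `2^{a+1}`-th root of
# unity with no `2^{a+2}`-th one, and the lifting-the-exponent reduction to `2^{a+2} ∤ p − 1`, `2^{a+1} ∤ p + 1`

COR-CM (cell `pub-hodgecm2`), binder seat b04 (gen 26), count-neutral claim CYCLIC-SEMIDIRECT-RESIDUE, part IIIa♯ — the three
Mathlib-only arithmetic inputs of the residue-field chain (`CorCM/CyclotomicTwoPowerPResidue{Descent,Obstruction}`,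
`CorCM/GaloisCyclicSemidirectTwoPowerResidue`).  KERNEL ONLY: theorems; no definition, no named fact, no `sorry`.

* `exists_exp` — an exponent `e ≡ 1 (mod 2^{a+1})`, `e ≡ −1 (mod p)` (`Nat.chineseRemainder`); `ζ ↦ ζ^e` is the automorphism
  of `ℚ(ζ_{2^{a+1}p})` fixing `μ_{2^{a+1}}` and inverting `μ_p`.
* `exists_residue` — if `2^{a+1} ∣ p^f − 1` and `2^{a+2} ∤ p^f − 1` then `GaloisField p f` has an `s` with `s^{2^a} = −1` and no
  `x` with `x^{2^{a+1}} = −1` (cyclic unit group; `orderOf_eq_prime_pow`).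
* `exists_pow_sub_one_of_not_dvd` — `2^{a+2} ∤ p − 1` and `2^{a+1} ∤ p + 1` ⟹ such an `f` exists (`f = 1` or
  `f = 2^{a+2−v₂(p−1)−v₂(p+1)}`, Mathlib `padicValNat.pow_two_sub_one`).

## References

* [FeinGordonSmith1971] B. Fein, B. Gordon, J. H. Smith, J. Number Theory 3 (1971), 310–315 (the `2`-adic analogue).
* [Washington1997] L. C. Washington, *Introduction to Cyclotomic Fields*, Thm. 2.13.
-/

noncomputable section

namespace Summit.HodgeConjecture.CorCM.CyclotomicTwoPowerP.Residue

variable {p a : ℕ}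

/-- **An exponent `e ≡ 1 (mod 2^{a+1})`, `e ≡ −1 (mod p)`** (`p` an odd prime; Chinese remainder theorem). [folklore] -/
theorem exists_exp (hp : p.Prime) (hp2 : p ≠ 2) : ∃ e : ℕ, e % 2 ^ (a + 1) = 1 ∧ (e + 1) % p = 0 := by
  have hco : (2 ^ (a + 1)).Coprime p :=
    Nat.Coprime.pow_left _ ((Nat.coprime_primes Nat.prime_two hp).2 hp2.symm)
  obtain ⟨e, he1, he2⟩ := Nat.chineseRemainder hco 1 (p - 1)
  refine ⟨e, ?_, ?_⟩
  · have h1 : e % 2 ^ (a + 1) = 1 % 2 ^ (a + 1) := he1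
    rw [h1]
    exact Nat.mod_eq_of_lt (Nat.one_lt_pow (Nat.succ_ne_zero a) (by norm_num : 1 < 2))
  · have h := he2.add_right 1
    rw [Nat.sub_add_cancel hp.one_le] at h
    have h' : (e + 1) % p = p % p := h
    rw [h', Nat.mod_self]

/-- **The residue field `𝔽_{p^f}`**: if `2^{a+1} ∣ p^f − 1` and `2^{a+2} ∤ p^f − 1` then `𝔽_{p^f}` contains an `s` with
`s^{2^a} = −1` (a primitive `2^{a+1}`-th root of unity: `𝔽_{p^f}ˣ` is cyclic) and NO `x` with `x^{2^{a+1}} = −1` (such an `x`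
would have order `2^{a+2}`). [folklore] -/
theorem exists_residue [Fact p.Prime] (hp2 : p ≠ 2) {f : ℕ} (hf1 : 2 ^ (a + 1) ∣ p ^ f - 1)
    (hf2 : ¬ 2 ^ (a + 2) ∣ p ^ f - 1) :
    ∃ s : GaloisField p f, s ^ 2 ^ a = -1 ∧ ∀ x : GaloisField p f, x ^ 2 ^ (a + 1) ≠ -1 := by
  have hf0 : f ≠ 0 := by
    rintro rfl
    simp at hf2
  have hcard : Nat.card (GaloisField p f)ˣ = p ^ f - 1 := by
    rw [Nat.card_units, GaloisField.card p f hf0]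
  have hc0 : p ^ f - 1 ≠ 0 := fun h => by
    rw [h] at hf2
    exact hf2 (dvd_zero _)
  have hm1 : (-1 : GaloisField p f) ≠ 1 := by
    refine Ring.neg_one_ne_one_of_char_ne_two ?_
    rw [ringChar.eq (GaloisField p f) p]
    exact hp2
  -- a generator of the cyclic group of units and the element of order `2^{a+1}`
  obtain ⟨g₀, hg₀⟩ := IsCyclic.exists_generator (α := (GaloisField p f)ˣ)
  have hog : orderOf g₀ = p ^ f - 1 := (orderOf_eq_card_of_forall_mem_zpowers hg₀).trans hcard
  have hq0 : (p ^ f - 1) / 2 ^ (a + 1) ≠ 0 :=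
    (Nat.div_pos (Nat.le_of_dvd (Nat.pos_of_ne_zero hc0) hf1) (by positivity)).ne'
  set u := g₀ ^ ((p ^ f - 1) / 2 ^ (a + 1)) with hu_def
  have hou : orderOf u = 2 ^ (a + 1) := by
    rw [hu_def, orderOf_pow' g₀ hq0, hog, Nat.gcd_eq_right (Nat.div_dvd_of_dvd hf1), Nat.div_div_self hf1 hc0]
  refine ⟨(u : GaloisField p f) ^ 1, ?_, fun x hx => ?_⟩
  · rw [pow_one]
    have h1 : (u : GaloisField p f) ^ 2 ^ a * (u : GaloisField p f) ^ 2 ^ a = 1 := by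
      rw [← pow_two, ← pow_mul, ← pow_succ, ← hou, ← Units.val_pow_eq_pow_val, pow_orderOf_eq_one, Units.val_one]
    have hne : (u : GaloisField p f) ^ 2 ^ a ≠ 1 := by
      intro h
      have hu1 : u ^ 2 ^ a = 1 := Units.ext (by rw [Units.val_pow_eq_pow_val, h, Units.val_one])
      refine pow_ne_one_of_lt_orderOf (by positivity) ?_ hu1
      rw [hou]
      exact Nat.pow_lt_pow_right (by norm_num) (by omega)
    rcases mul_self_eq_one_iff.1 h1 with h | h
    · exact absurd h hne
    · exact h
  · -- an `x` with `x^{2^{a+1}} = −1` is a unit of order `2^{a+2}`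
    have hx0 : x ≠ 0 := by
      rintro rfl
      rw [zero_pow (by positivity)] at hx
      exact (neg_ne_zero.2 (one_ne_zero (α := GaloisField p f))) hx.symm
    set v := Units.mk0 x hx0 with hv_def
    have hv1 : ¬ v ^ 2 ^ (a + 1) = 1 := fun h => by
      have h' : (v : GaloisField p f) ^ 2 ^ (a + 1) = 1 := by
        rw [← Units.val_pow_eq_pow_val, h, Units.val_one]
      rw [hv_def, Units.val_mk0, hx] at h'
      exact hm1 h'
    have hv2 : v ^ 2 ^ (a + 1 + 1) = 1 := by
      refine Units.ext ?_
      rw [Units.val_pow_eq_pow_val, hv_def, Units.val_mk0, pow_succ, pow_mul, hx, neg_one_sq, Units.val_one]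
    have hov : orderOf v = 2 ^ (a + 1 + 1) := orderOf_eq_prime_pow hv1 hv2
    have hdvd : 2 ^ (a + 2) ∣ p ^ f - 1 := by
      rw [← hcard, show a + 2 = a + 1 + 1 by ring, ← hov]
      exact orderOf_dvd_natCard v
    exact hf2 hdvd

/-- **Lifting the exponent.**  `p` an odd prime with `2^{a+2} ∤ p − 1` and `2^{a+1} ∤ p + 1`: some `f` (namely `f = 1` if
`2^{a+1} ∣ p − 1`, else `f = 2^{a+2−v₂(p−1)−v₂(p+1)}`) has `2^{a+1} ∣ p^f − 1` and `2^{a+2} ∤ p^f − 1`, by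
`v₂(p^{2^t} − 1) = v₂(p − 1) + v₂(p + 1) + t − 1`. [folklore] -/
theorem exists_pow_sub_one_of_not_dvd (hp : p.Prime) (hp2 : p ≠ 2) (h1 : ¬ 2 ^ (a + 2) ∣ p - 1)
    (h2 : ¬ 2 ^ (a + 1) ∣ p + 1) : ∃ f : ℕ, 2 ^ (a + 1) ∣ p ^ f - 1 ∧ ¬ 2 ^ (a + 2) ∣ p ^ f - 1 := by
  haveI : Fact (Nat.Prime 2) := ⟨Nat.prime_two⟩
  have hp3 := hp.two_le
  have hodd : ¬ 2 ∣ p := fun h => hp2 ((Nat.prime_dvd_prime_iff_eq Nat.prime_two hp).1 h).symm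
  have hm0 : p - 1 ≠ 0 := by omega
  have hp0 : p + 1 ≠ 0 := by omega
  have h2m : 2 ^ 1 ∣ p - 1 := by rw [pow_one]; clear h1 h2; omega
  have h2p : 2 ^ 1 ∣ p + 1 := by rw [pow_one]; clear h1 h2; omega
  have hbm1 : 1 ≤ padicValNat 2 (p - 1) := (padicValNat_dvd_iff_le hm0).1 h2m
  have hbp1 : 1 ≤ padicValNat 2 (p + 1) := (padicValNat_dvd_iff_le hp0).1 h2p
  have hbp_le : padicValNat 2 (p + 1) ≤ a := by
    by_contra h
    exact h2 ((padicValNat_dvd_iff_le hp0).2 (by omega))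
  by_cases hcase : a + 1 ≤ padicValNat 2 (p - 1)
  · refine ⟨1, ?_, ?_⟩
    · rw [pow_one]; exact (padicValNat_dvd_iff_le hm0).2 hcase
    · rw [pow_one]; exact h1
  · -- the valuations of `p − 1` and `p + 1` are not both `≥ 2`
    have hmin : padicValNat 2 (p - 1) ≤ 1 ∨ padicValNat 2 (p + 1) ≤ 1 := by
      by_contra h
      push Not at h
      have h4m : 2 ^ 2 ∣ p - 1 := (padicValNat_dvd_iff_le hm0).2 h.1
      have h4p : 2 ^ 2 ∣ p + 1 := (padicValNat_dvd_iff_le hp0).2 h.2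
      norm_num at h4m h4p
      clear h1 h2 h2m h2p
      omega
    set t := a + 2 - (padicValNat 2 (p - 1) + padicValNat 2 (p + 1)) with ht_def
    have hsum : padicValNat 2 (p + 1) + padicValNat 2 (p - 1) + t = a + 2 := by omega
    have hf0 : 2 ^ t ≠ 0 := by positivity
    have hfev : Even (2 ^ t) := Nat.even_pow.2 ⟨even_two, by omega⟩
    have hLTE := padicValNat.pow_two_sub_one hp.one_lt hodd hf0 hfev
    rw [padicValNat.prime_pow] at hLTE
    have hv : padicValNat 2 (p ^ 2 ^ t - 1) = a + 1 := by omega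
    have hN0 : p ^ 2 ^ t - 1 ≠ 0 := by
      have : 1 < p ^ 2 ^ t := Nat.one_lt_pow hf0 hp.one_lt
      omega
    refine ⟨2 ^ t, (padicValNat_dvd_iff_le hN0).2 hv.ge, fun h => ?_⟩
    have := (padicValNat_dvd_iff_le hN0).1 h
    omega


end Summit.HodgeConjecture.CorCM.CyclotomicTwoPowerP.Residue

end
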